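import Mathlib
import Literature.NumberTheory.Transcendental.KZCubeRational
import Summits.KontsevichZagierPeriods.KontsevichZagierPeriods.Theorems.InverseLandauTateFamilyKernelOpenCube

/-!
# Crux `TateFamilyKernel` (stmt-KontsevichZagierPeriods-9130), line `Sketch` — stub `stub_linExact`

Last step of the LINEAR CLASS theorem of the lead's skeleton (dimension `2`,
`Q = 1 − ϖ(α + βz₂)z₁`, `0 < α`, `0 < β`, `P` free of `ϖ`): Griffiths exactness AT THE FIBRE `ϖ₀`.
Write `x = z₁ = X 0`, `s = z₂ = X 1`, `ϖ = X (Fin.last 2)`, `W = α + βs` (`> 0` on `[0,1]`).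
The residue step (`stub_linResidues`) hands over `k : ℕ` and `M ∈ ℚ[y, s]` with
`d/ds (M(y,s)/W(s)^k) = P(y/W(s), s)/W(s)` for all real `y, s` with `W(s) ≠ 0`; in algebraic form
(uniqueness of derivatives, `LinExact.key_identity`)

  `P(y/W, s) · W^k = (∂_s M)(y, s) · W − kβ · M(y, s)`.

Put `Φ(x, s) = M(xW, s)/W^k`. The vector field `V = −βx ∂_x + W ∂_s` is divergence free, kills
`xW` (hence `h = 1/Q`, a function of `xW` and `ϖ`), and `V(Φ) = P` by the identity above; so
`P/Q = h·V(Φ) = ∂_x(−βxΦh) + ∂_s(WΦh)`. Clearing `W^k`, the certificate is the two-term datum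
`A₀/D = −βxW·M(xW,s) / (W^{k+1} Q)` along `x` and `A₁/D = W²·M(xW,s) / (W^{k+1} Q)` along `s`,
`ℚ`-polynomial in `(x, s, ϖ)`, with `D = W^{k+1} Q ≠ 0` on the closed square at `ϖ₀` — exactly the
input of the landed `stub_exactFibreTwo`. The verification is the chain rule for `pderiv` under
`bind₁` (`LinExact.pderiv_bind₁`), evaluation, and one rational identity (`LinExact.cert`).
The hypothesis `0 < ϖ₀` of the registered signature is not needed (the identity holds at every real
`ϖ₀` with `Q(·, ϖ₀) ≠ 0` on the square). No named fact, no new definition. References: Kontsevich–Zagier 2001 §1.2 (rule (3), Stokes);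
Griffiths 1969 (reduction of pole order).
-/

noncomputable section

open MeasureTheory Set MvPolynomial
open Literature.NumberTheory.Transcendental

namespace Summit.KontsevichZagierPeriods.InverseLandau.TateFamilyKernel.Descent

namespace LinExact

/-- **Chain rule for `pderiv` under substitution**: for a polynomial map `f = (f_l)_l` and a
polynomial `g`, `∂ⱼ (g ∘ f) = Σ_l ∂ⱼ f_l · (∂_l g) ∘ f`. [folklore] -/
theorem pderiv_bind₁ {n m : ℕ} (f : Fin n → MvPolynomial (Fin m) ℚ) (j : Fin m)
    (g : MvPolynomial (Fin n) ℚ) :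
    pderiv j (bind₁ f g) = ∑ l, pderiv j (f l) * bind₁ f (pderiv l g) := by
  -- adapted from Literature/AlgebraicGeometry/Motives/PolyFormPullback.lean (`dirDeriv_bind₁`)
  induction g using MvPolynomial.induction_on with
  | C a => simp
  | add p q hp hq => simp only [map_add, hp, hq, mul_add, Finset.sum_add_distrib]
  | mul_X p l hp =>
    have h1 : ∀ l', pderiv j (f l') * bind₁ f (pderiv l' (p * X l)) =
        f l * (pderiv j (f l') * bind₁ f (pderiv l' p)) +
          (if l = l' then bind₁ f p * pderiv j (f l') else 0) := by
      intro l'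
      rw [pderiv_mul, pderiv_X, map_add, map_mul, map_mul, bind₁_X_right, Pi.single_apply]
      split_ifs with h
      · simp only [map_one, mul_one]; ring
      · simp only [map_zero, mul_zero, add_zero]; ring
    rw [Finset.sum_congr rfl fun l' _ => h1 l', Finset.sum_add_distrib, Finset.sum_ite_eq,
      if_pos (Finset.mem_univ l), ← Finset.mul_sum, ← hp, map_mul, bind₁_X_right,
      Derivation.leibniz, smul_eq_mul, smul_eq_mul]
    ring

/-- The `s`-derivative of `s ↦ R(y, s)` is `(∂₁ R)(y, s)`. [folklore] -/
theorem hasDerivAt_aeval_snd (R : MvPolynomial (Fin 2) ℚ) (y s : ℝ) :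
    HasDerivAt (fun s' : ℝ => aeval ![y, s'] R) (aeval ![y, s] (pderiv 1 R)) s := by
  -- adapted from Theorems/SymplecticScissorsCurvePeriodsTransferStubSaPieceFacts.lean
  induction R using MvPolynomial.induction_on with
  | C a =>
    simp only [MvPolynomial.aeval_C, MvPolynomial.pderiv_C, map_zero]
    exact hasDerivAt_const s _
  | add p q hp hq =>
    simp only [map_add]
    exact hp.add hq
  | mul_X p i hp =>
    fin_cases i
    · simp only [Fin.zero_eta, map_mul, MvPolynomial.aeval_X, Matrix.cons_val_zero]
      refine (hp.mul_const y).congr_deriv ?_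
      rw [mul_comm]
      simp
    · simp only [Fin.mk_one, map_mul, MvPolynomial.aeval_X, Matrix.cons_val_one]
      refine (hp.mul (hasDerivAt_id' s)).congr_deriv ?_
      rw [mul_one, add_comm, mul_comm]
      simp

/-- **The residue datum in algebraic form.** If `d/ds (M(y,s)/W(s)^k) = P(y/W(s), s)/W(s)`,
`W = α + βs`, then `P(y/W, s)·W^k = (∂_s M)(y,s)·W − kβ·M(y,s)` wherever `W(s) ≠ 0`
(uniqueness of the derivative). [folklore] -/
theorem key_identity (α β : ℚ) (P : MvPolynomial (Fin 2) ℚ) (k : ℕ) (M : MvPolynomial (Fin 2) ℚ)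
    (hM : ∀ (y s : ℝ), (α : ℝ) + β * s ≠ 0 →
      HasDerivAt (fun s' : ℝ => aeval ![y, s'] M / ((α : ℝ) + β * s') ^ k)
        (aeval ![y / ((α : ℝ) + β * s), s] P / ((α : ℝ) + β * s)) s)
    (y s : ℝ) (hW : (α : ℝ) + β * s ≠ 0) :
    aeval ![y / ((α : ℝ) + β * s), s] P * ((α : ℝ) + β * s) ^ k =
      aeval ![y, s] (pderiv 1 M) * ((α : ℝ) + β * s) - k * β * aeval ![y, s] M := by
  have h1 := hasDerivAt_aeval_snd M y s
  have h2 : HasDerivAt (fun s' : ℝ => (α : ℝ) + β * s') (β : ℝ) s := by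
    simpa using ((hasDerivAt_id s).const_mul (β : ℝ)).const_add (α : ℝ)
  have h4 := h1.div (h2.fun_pow k) (pow_ne_zero k hW)
  have h5 := (hM y s hW).unique h4
  have hk : (k : ℝ) * ((α : ℝ) + β * s) ^ (k - 1) * ((α : ℝ) + β * s) =
      k * ((α : ℝ) + β * s) ^ k := by
    cases k with
    | zero => simp
    | succ n => rw [Nat.add_sub_cancel, pow_succ]; ring
  rw [div_eq_div_iff hW (pow_ne_zero 2 (pow_ne_zero k hW))] at h5
  apply mul_right_cancel₀ (pow_ne_zero k hW)
  linear_combination h5 - aeval ![y, s] M * β * hk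

/-- **The rational identity behind the certificate** (`W, Q` the values of `α + βs` and of `Q`,
`a, b, c` the values of `∂₀M, ∂₁M, M` at `(xW, s)`, `P` the value of `P` at `(x, s)`, `p = ϖ₀`):
`P/Q = ∂_x(A₀/D) + ∂_s(A₁/D)` written out by the quotient rule. [folklore] -/
theorem cert (a b c x p β W Q P : ℝ) (k : ℕ) (hW : W ≠ 0) (hQ : Q ≠ 0)
    (hP : P * W ^ k = b * W - k * β * c) :
    P / Q =
      ((-(β * W * c + β * x * W * (W * a))) * (W ^ (k + 1) * Q) -
          (-(β * x * W * c)) * (W ^ (k + 1) * (-(p * W)))) / (W ^ (k + 1) * Q) ^ 2 +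
      ((2 * W * β * c + W ^ 2 * (x * β * a + b)) * (W ^ (k + 1) * Q) -
          (W ^ 2 * c) * ((k + 1) * W ^ k * β * Q + W ^ (k + 1) * (-(p * x * β)))) /
        (W ^ (k + 1) * Q) ^ 2 := by
  have hD : (W ^ (k + 1) * Q) ^ 2 ≠ 0 := pow_ne_zero 2 (mul_ne_zero (pow_ne_zero _ hW) hQ)
  rw [← add_div, div_eq_div_iff hQ hD]
  linear_combination (W ^ (k + 2) * Q ^ 2) * hP

end LinExact

open LinExact in
/-- **Linear class, exactness at the fibre** (stub `stub_linExact` of the crux `TateFamilyKernel`,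
line `Sketch`). For `Q = 1 − ϖ(α + βz₂)z₁` with `0 < α`, `0 < β`, a `ϖ`-free `P`, and the residue
datum `d/ds (M(y,s)/W^k) = P(y/W, s)/W` (`W = α + βs`), the fibre `P/Q(·, ϖ₀)` is Griffiths-exact on
the closed square with `ℚ`-polynomial data regular there:
`P/Q = ∂_{z₁}(A₀/D) + ∂_{z₂}(A₁/D)` at `ϖ₀`, `A₀ = −βz₁W·M(z₁W, z₂)`, `A₁ = W²·M(z₁W, z₂)`,
`D = W^{k+1}Q` (the divergence-free field `−βz₁∂₁ + W∂₂` applied to `M(z₁W,z₂)/W^k`, times `1/Q`).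
[cite: KontsevichZagier2001, §1.2] -/
theorem stub_linExact (α β : ℚ) (P : MvPolynomial (Fin 2) ℚ) (hα : 0 < α) (hβ : 0 < β)
    (k : ℕ) (M : MvPolynomial (Fin 2) ℚ)
    (hM : ∀ (y s : ℝ), (α : ℝ) + β * s ≠ 0 →
      HasDerivAt (fun s' : ℝ => aeval ![y, s'] M / ((α : ℝ) + β * s') ^ k)
        (aeval ![y / ((α : ℝ) + β * s), s] P / ((α : ℝ) + β * s)) s)
    (ϖ₀ : ℝ) (hϖ₀ : 0 < ϖ₀)
    (hQ : ∀ w ∈ KZ.cube 2, aeval (Fin.snoc w ϖ₀ : Fin (2 + 1) → ℝ)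
      (1 - X (Fin.last 2) * (C α + C β * X 1) * X 0 : MvPolynomial (Fin (2 + 1)) ℚ) ≠ 0) :
    ∃ (K : ℕ) (i : Fin K → Fin 2) (A Dn : Fin K → MvPolynomial (Fin (2 + 1)) ℚ),
      (∀ k, ∀ w ∈ KZ.cube 2, aeval (Fin.snoc w ϖ₀ : Fin (2 + 1) → ℝ) (Dn k) ≠ 0) ∧
      (∀ w ∈ KZ.cube 2,
        aeval (Fin.snoc w ϖ₀ : Fin (2 + 1) → ℝ) (rename Fin.castSucc P) /
            aeval (Fin.snoc w ϖ₀ : Fin (2 + 1) → ℝ)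
              (1 - X (Fin.last 2) * (C α + C β * X 1) * X 0 : MvPolynomial (Fin (2 + 1)) ℚ) =
          ∑ k, aeval (Fin.snoc w ϖ₀ : Fin (2 + 1) → ℝ)
              (pderiv (Fin.castSucc (i k)) (A k) * Dn k -
                A k * pderiv (Fin.castSucc (i k)) (Dn k)) /
            aeval (Fin.snoc w ϖ₀ : Fin (2 + 1) → ℝ) (Dn k ^ 2)) := by
  have _ := hϖ₀
  -- the polynomial data (`X 0 = z₁`, `X 1 = z₂ = s`, `X (Fin.last 2) = ϖ`)
  obtain ⟨W, hW⟩ : ∃ W : MvPolynomial (Fin (2 + 1)) ℚ, W = C α + C β * X 1 := ⟨_, rfl⟩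
  obtain ⟨Qp, hQp⟩ : ∃ Qp : MvPolynomial (Fin (2 + 1)) ℚ, Qp = 1 - X (Fin.last 2) * W * X 0 :=
    ⟨_, rfl⟩
  obtain ⟨φ, hφ⟩ : ∃ φ : Fin 2 → MvPolynomial (Fin (2 + 1)) ℚ, φ = ![X 0 * W, X 1] := ⟨_, rfl⟩
  have hQp' :
      (1 - X (Fin.last 2) * (C α + C β * X 1) * X 0 : MvPolynomial (Fin (2 + 1)) ℚ) = Qp := by
    rw [hQp, hW]
  rw [hQp'] at hQ ⊢
  -- symbolic partial derivatives
  have h10 : (1 : Fin (2 + 1)) ≠ 0 := by decide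
  have hL0 : (Fin.last 2 : Fin (2 + 1)) ≠ 0 := by decide
  have hL1 : (Fin.last 2 : Fin (2 + 1)) ≠ 1 := by decide
  have hW0 : pderiv 0 W = 0 := by
    rw [hW, map_add, pderiv_C, Derivation.leibniz, pderiv_C, pderiv_X_of_ne h10]
    simp
  have hW1 : pderiv 1 W = C β := by
    rw [hW, map_add, pderiv_C, Derivation.leibniz, pderiv_C, pderiv_X_self]
    simp
  have hφ00 : pderiv 0 (φ 0) = W := by
    rw [hφ, Matrix.cons_val_zero, Derivation.leibniz, hW0, pderiv_X_self]
    simp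
  have hφ01 : pderiv 0 (φ 1) = 0 := by
    rw [hφ, Matrix.cons_val_one, Matrix.cons_val_fin_one, pderiv_X_of_ne h10]
  have hφ10 : pderiv 1 (φ 0) = X 0 * C β := by
    rw [hφ, Matrix.cons_val_zero, Derivation.leibniz, hW1, pderiv_X_of_ne h10.symm]
    simp
  have hφ11 : pderiv 1 (φ 1) = 1 := by
    rw [hφ, Matrix.cons_val_one, Matrix.cons_val_fin_one, pderiv_X_self]
  have hM0 : pderiv 0 (bind₁ φ M) = W * bind₁ φ (pderiv 0 M) := by
    rw [pderiv_bind₁, Fin.sum_univ_two, hφ00, hφ01, zero_mul, add_zero]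
  have hM1 : pderiv 1 (bind₁ φ M) = X 0 * C β * bind₁ φ (pderiv 0 M) + bind₁ φ (pderiv 1 M) := by
    rw [pderiv_bind₁, Fin.sum_univ_two, hφ10, hφ11, one_mul]
  have hQ0 : pderiv 0 Qp = -(X (Fin.last 2) * W) := by
    rw [hQp, map_sub, Derivation.map_one_eq_zero, Derivation.leibniz, pderiv_X_self,
      Derivation.leibniz, hW0, pderiv_X_of_ne hL0]
    simp
  have hQ1 : pderiv 1 Qp = -(X (Fin.last 2) * X 0 * C β) := by
    rw [hQp, map_sub, Derivation.map_one_eq_zero, Derivation.leibniz, pderiv_X_of_ne h10.symm,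
      Derivation.leibniz, hW1, pderiv_X_of_ne hL1]
    simp
    ring
  have hD0 : pderiv 0 (W ^ (k + 1) * Qp) = W ^ (k + 1) * (-(X (Fin.last 2) * W)) := by
    rw [Derivation.leibniz, Derivation.leibniz_pow, hW0, hQ0]
    simp
  have hD1 : pderiv 1 (W ^ (k + 1) * Qp) =
      ((k : MvPolynomial (Fin (2 + 1)) ℚ) + 1) * W ^ k * C β * Qp +
        W ^ (k + 1) * (-(X (Fin.last 2) * X 0 * C β)) := by
    rw [Derivation.leibniz, Derivation.leibniz_pow, hW1, hQ1, Nat.add_sub_cancel]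
    simp only [smul_eq_mul, nsmul_eq_mul, Nat.cast_add, Nat.cast_one]
    ring
  have hA0 : pderiv 0 (-(C β * X 0 * W * bind₁ φ M)) =
      -(C β * W * bind₁ φ M + C β * X 0 * W * (W * bind₁ φ (pderiv 0 M))) := by
    rw [map_neg, Derivation.leibniz, hM0, Derivation.leibniz, hW0, Derivation.leibniz,
      pderiv_X_self, pderiv_C]
    simp only [smul_eq_mul, mul_one]
    ring
  have hA1 : pderiv 1 (W ^ 2 * bind₁ φ M) =
      2 * W * C β * bind₁ φ M +
        W ^ 2 * (X 0 * C β * bind₁ φ (pderiv 0 M) + bind₁ φ (pderiv 1 M)) := by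
    rw [Derivation.leibniz, Derivation.leibniz_pow, hW1, hM1]
    simp only [smul_eq_mul, nsmul_eq_mul, Nat.cast_ofNat, Nat.add_one_sub_one, pow_one]
    ring
  refine ⟨2, ![0, 1], ![-(C β * X 0 * W * bind₁ φ M), W ^ 2 * bind₁ φ M], fun _ => W ^ (k + 1) * Qp,
    fun _ w hw => ?_, fun w hw => ?_⟩
  · -- the common denominator `W^{k+1} Q` does not vanish on the closed square at `ϖ₀`
    have hv1 : (Fin.snoc w ϖ₀ : Fin (2 + 1) → ℝ) 1 = w 1 := rfl
    have hs := KZ.mem_cube.1 hw 1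
    have hWr : (0 : ℝ) < α + β * w 1 := by
      have : (0 : ℝ) < α := by exact_mod_cast hα
      have : (0 : ℝ) ≤ β := by exact_mod_cast hβ.le
      nlinarith [hs.1]
    have heW : aeval (Fin.snoc w ϖ₀ : Fin (2 + 1) → ℝ) W = α + β * w 1 := by
      simp [hW, hv1]
    rw [map_mul, map_pow, heW]
    exact mul_ne_zero (pow_ne_zero _ hWr.ne') (hQ w hw)
  · -- the pointwise identity on the closed square at `ϖ₀`
    have hv0 : (Fin.snoc w ϖ₀ : Fin (2 + 1) → ℝ) 0 = w 0 := rfl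
    have hv1 : (Fin.snoc w ϖ₀ : Fin (2 + 1) → ℝ) 1 = w 1 := rfl
    have hs := KZ.mem_cube.1 hw 1
    have hWr : (0 : ℝ) < α + β * w 1 := by
      have : (0 : ℝ) < α := by exact_mod_cast hα
      have : (0 : ℝ) ≤ β := by exact_mod_cast hβ.le
      nlinarith [hs.1]
    -- evaluation of the data at `(w, ϖ₀)`
    have heW : aeval (Fin.snoc w ϖ₀ : Fin (2 + 1) → ℝ) W = α + β * w 1 := by
      simp [hW, hv1]
    have hφv : (fun l => aeval (Fin.snoc w ϖ₀ : Fin (2 + 1) → ℝ) (φ l)) =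
        ![w 0 * (α + β * w 1), w 1] := by
      funext l
      fin_cases l
      · simp [hφ, heW, hv0]
      · simp [hφ, hv1]
    have heB : ∀ R : MvPolynomial (Fin 2) ℚ, aeval (Fin.snoc w ϖ₀ : Fin (2 + 1) → ℝ) (bind₁ φ R) =
        aeval ![w 0 * (α + β * w 1), w 1] R := by
      intro R
      rw [aeval_bind₁, hφv]
    have hvw : (Fin.snoc w ϖ₀ : Fin (2 + 1) → ℝ) ∘ Fin.castSucc = w := by
      funext l
      simp
    have heP : aeval (Fin.snoc w ϖ₀ : Fin (2 + 1) → ℝ) (rename Fin.castSucc P) = aeval w P := by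
      rw [aeval_rename, hvw]
    -- the residue datum at `y = w₀ W`, `s = w₁`
    have hk := key_identity α β P k M hM (w 0 * (α + β * w 1)) (w 1) hWr.ne'
    rw [mul_div_cancel_right₀ _ hWr.ne'] at hk
    have hvec : (![w 0, w 1] : Fin 2 → ℝ) = w := by
      funext l
      fin_cases l <;> rfl
    rw [hvec] at hk
    have hc0 : (Fin.castSucc (0 : Fin 2) : Fin (2 + 1)) = 0 := rfl
    have hc1 : (Fin.castSucc (1 : Fin 2) : Fin (2 + 1)) = 1 := rfl
    simp only [Fin.sum_univ_two, Matrix.cons_val_zero, Matrix.cons_val_one, Matrix.cons_val_fin_one,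
      hc0, hc1]
    rw [hA0, hD0, hA1, hD1, heP]
    simp only [map_sub, map_mul, map_neg, map_add, map_pow, map_natCast, map_one, map_ofNat,
      MvPolynomial.aeval_C, aeval_X, eq_ratCast, Fin.snoc_last, hv0, heW, heB]
    exact cert _ _ _ (w 0) ϖ₀ β _ _ _ k hWr.ne' (hQ w hw) hk
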